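import Literature.Topology.FourManifolds.MorseChartChange
import Mathlib.LinearAlgebra.Matrix.Determinant.Basic
import Mathlib.Analysis.SpecialFunctions.Log.Basic
import HarnessLib

/-!
# S2β · LINE g18-1 · DET-REP-B‴ — HESSIAN CONGRUENCE AT A CRITICAL POINT (the identity behind the INTRINSIC seam)

Cell `ym3-torus` (rung R3: continuum `SU(2)` Yang–Mills on `T³` — NOT `d = 4`, NOT infinite volume, NOT a mass gap, NOT Clay); width seat
`ym-ust-20520-w5` g15; helper of the crux `stmt-QuantumFields-20520` (`--supports … --as helper`, NOT a proof of it).  Companion of the memos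
`FINDING-w5g15-DETREPB-DEPTH.md` (20520 evidence #50) and `FINDING2-w5g15-DETREPB-JAC-SPLIT.md` (#57) and of the DET-REP-B‴ candidate 8b0e9aaf (★★OWNER WORDs 77∕78):
there the organ row of `Cruxes/FluctuationComparisonRegPrIntL/Lines/semiclassical_s2beta.lean` was re-cut along the INTRINSIC seam of REP's exponent
`E = log c.jac + (log jV − ½·log det M_y)`, on the strength of the identity «at a critical point, `log det M_y − 2·log jV(y) = log det M^{normal}`» — the coordinate
Hessian `M_y` in the tube frame and the Hessian `M^{normal}` in exponential coordinates centred at the moving minimiser are CONGRUENT by the transition Jacobian `D`,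
`M_y = Dᵀ M^{normal} D`, and `|det D(y)| = jV(y)∕σ₀` (px21 g12 02:03:19Z: `jV y = σ₀·Π_b (sin‖(eV y)_b‖∕‖(eV y)_b‖)²`).  This file is the kernel side of that
identity, GENERIC (real normed spaces; no gauge theory, no charts of record):

* §1 (CITED, not restated): ✓`Literature.Topology.FourManifolds.fderiv_fderiv_comp_apply_of_fderiv_eq_zero` (`MorseChartChange.lean`, Milnor §2) — for
  `A : E → E′`, `φ : E′ → ℝ` of class `C²` with `Dφ_{A x} = 0`: `D²(φ ∘ A)ₓ(v)(w) = D²φ_{A x}(DAₓ v)(DAₓ w)` (the second-fundamental-form term drops).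
* §2 ★★`hessMatrix_comp_eq_of_fderiv_eq_zero` — MATRIX FORM: for any vector families `b : ι → E`, `b′ : κ → E′` and any real matrix `Jm` expanding the differential,
  `DAₓ (b i) = Σ_k Jm k i • b′ k`, the Hessian matrices (written inline with `Matrix.of`, no definition) satisfy
  `[D²(φ∘A)ₓ (b i) (b j)]_{ij} = Jmᵀ * [D²φ_{A x} (b′ k) (b′ l)]_{kl} * Jm`.
* §3 ★`log_det_transpose_mul_mul` — `Real.log (Jmᵀ * H * Jm).det = Real.log H.det + 2·Real.log |Jm.det|` (square case, `det H ≠ 0`, `det Jm ≠ 0`), and the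
  combination ★`log_det_hess_comp_sub_two_log_abs_det` = §2 + §3: `log det [D²(φ∘A)ₓ] − 2·log|det Jm| = log det [D²φ_{A x}]`.
READING (DET-REP-B‴): `φ` := the action through the window chart on the fibre manifold near the minimiser `u_t(s)`, `A` := the tube parametrisation `y ↦ c.Φ(x_t s, σ y)`
read in exponential coordinates centred at `u_t(s)`, `b = b′` := standard bases, `Jm = D(y_t s)`; then §3 is `log det M_y(s) − 2·log|det D(y_t s)| = log det M^{normal}(s)`,
and `|det D| = jV∕σ₀` makes DETN-ROW's `l − 2·log jV` the intrinsic determinant up to a corner-independent constant (which every 4-point VALUE tolerates).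

HONEST SCOPE.  Calculus + matrix algebra; def-free; default heartbeats; proves nothing of DET-REP-B‴ ∕ FOUR-POINT-DECAY ∕ S2β ∕ the crux 20520 (the factual input
`|det D| = jV∕σ₀` on px21's chart of record is NOT typed here); `YM3TorusSU2` NOT proved; the Yang–Mills mass gap (Clay) NOT proved.
References: [Dieudonne1960] Ch. VIII (8.12.10) (second derivative of a composite); [Milnor1963] §2 Lemma 2.2 (the Hessian at a critical point is a well-defined
bilinear form); [Helgason2000] Ch. II §1 Thm 1.7 (the differential of `exp`); [HornJohnson2013] §0.8 (determinant of a product ∕ congruence).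
-/

noncomputable section

open scoped Topology Matrix
open Filter Finset

namespace Summit.QuantumFields.YangMills.Theorems.FluctuationComparisonRegPrIntLS2BetaHessianCongruence

variable {E E' : Type*} [NormedAddCommGroup E] [NormedSpace ℝ E] [NormedAddCommGroup E'] [NormedSpace ℝ E']

/-! ## §2 Matrix form: congruence by the Jacobian of the coordinate change -/

/-- ★★ **HESSIAN MATRICES AT A CRITICAL POINT ARE CONGRUENT BY THE JACOBIAN.**  Let `A`, `φ` be `C²` with `Dφ_{A x} = 0`, and let `b : ι → E`, `b′ : κ → E′`
be vector families with the differential expanded as `DAₓ (b i) = Σ_k Jm k i • b′ k` (so `Jm` is the Jacobian matrix of `A` at `x` in these families).  Then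
`[D²(φ∘A)ₓ (b i) (b j)]_{ij} = Jmᵀ * [D²φ_{A x} (b′ k) (b′ l)]_{kl} * Jm`. [cite: Milnor1963, §2 Lemma 2.2] [cite: HornJohnson2013, §0.8 (congruence)] -/
theorem hessMatrix_comp_eq_of_fderiv_eq_zero {ι κ : Type*} [Fintype ι] [Fintype κ] {A : E → E'} {φ : E' → ℝ} {x : E}
    (hA : ContDiffAt ℝ 2 A x) (hφ : ContDiffAt ℝ 2 φ (A x)) (hcrit : fderiv ℝ φ (A x) = 0)
    (b : ι → E) (b' : κ → E') (Jm : Matrix κ ι ℝ) (hJ : ∀ i, fderiv ℝ A x (b i) = ∑ k, Jm k i • b' k) :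
    (Matrix.of fun i j => fderiv ℝ (fderiv ℝ (φ ∘ A)) x (b i) (b j)) =
      Jmᵀ * (Matrix.of fun k l => fderiv ℝ (fderiv ℝ φ) (A x) (b' k) (b' l)) * Jm := by
  ext i j
  set H : E' →L[ℝ] E' →L[ℝ] ℝ := fderiv ℝ (fderiv ℝ φ) (A x) with hH
  rw [Matrix.of_apply, Literature.Topology.FourManifolds.fderiv_fderiv_comp_apply_of_fderiv_eq_zero hφ hA hcrit, ← hH, hJ i, hJ j]
  -- expand the bilinear form on the two sums
  have h1 : ∀ (v : E'), H (∑ k, Jm k i • b' k) v = ∑ k, Jm k i * H (b' k) v := by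
    intro v
    rw [map_sum, FunLike.coe_sum, Finset.sum_apply]
    refine Finset.sum_congr rfl fun k _ => ?_
    rw [map_smul, FunLike.coe_smul, Pi.smul_apply, smul_eq_mul]
  have h2 : ∀ (k : κ), H (b' k) (∑ l, Jm l j • b' l) = ∑ l, Jm l j * H (b' k) (b' l) := by
    intro k
    rw [map_sum]
    refine Finset.sum_congr rfl fun l _ => ?_
    rw [map_smul, smul_eq_mul]
  rw [h1]
  simp_rw [h2]
  -- the matrix side
  simp_rw [Matrix.mul_apply, Matrix.transpose_apply, Matrix.of_apply, Finset.sum_mul, Finset.mul_sum]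
  rw [Finset.sum_comm]
  refine Finset.sum_congr rfl fun l _ => Finset.sum_congr rfl fun k _ => ?_
  ring

/-! ## §3 Determinants: `log det (Jᵀ H J) = log det H + 2·log|det J|` -/

/-- ★ **`log det (Jmᵀ * H * Jm) = log det H + 2·log |det Jm|`** for square real matrices with `det H ≠ 0`, `det Jm ≠ 0`. [cite: HornJohnson2013, §0.8 (det of a product)] -/
theorem log_det_transpose_mul_mul {ι : Type*} [Fintype ι] [DecidableEq ι] (H Jm : Matrix ι ι ℝ) (hH : H.det ≠ 0) (hJ : Jm.det ≠ 0) :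
    Real.log (Jmᵀ * H * Jm).det = Real.log H.det + 2 * Real.log |Jm.det| := by
  rw [Matrix.det_mul, Matrix.det_mul, Matrix.det_transpose]
  have h1 : Jm.det * H.det * Jm.det = H.det * (|Jm.det| * |Jm.det|) := by
    rw [abs_mul_abs_self]; ring
  rw [h1, Real.log_mul hH (mul_ne_zero (abs_ne_zero.mpr hJ) (abs_ne_zero.mpr hJ)),
    Real.log_mul (abs_ne_zero.mpr hJ) (abs_ne_zero.mpr hJ)]
  ring

/-- ★ **THE SEAM IDENTITY, KERNEL SIDE**: under §2's hypotheses with square families (`ι = κ`) and non-degenerate Hessian ∕ Jacobian,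
`log det [D²(φ∘A)ₓ (b i) (b j)] − 2·log |det Jm| = log det [D²φ_{A x} (b′ k) (b′ l)]` — «coordinate Hessian determinant minus twice the log-Jacobian of the
coordinate change = the Hessian determinant in the target coordinates».  With `|det Jm| = jV∕σ₀` (the transversal Haar density of the tube, px21's (F4b′)) this is
DET-REP-B‴'s `l − 2·log jV = log det M^{normal} + const`. [cite: Milnor1963, §2 Lemma 2.2] [cite: HornJohnson2013, §0.8] -/
theorem log_det_hess_comp_sub_two_log_abs_det {ι : Type*} [Fintype ι] [DecidableEq ι] {A : E → E'} {φ : E' → ℝ} {x : E}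
    (hA : ContDiffAt ℝ 2 A x) (hφ : ContDiffAt ℝ 2 φ (A x)) (hcrit : fderiv ℝ φ (A x) = 0)
    (b : ι → E) (b' : ι → E') (Jm : Matrix ι ι ℝ) (hJ : ∀ i, fderiv ℝ A x (b i) = ∑ k, Jm k i • b' k)
    (hH : (Matrix.of fun k l => fderiv ℝ (fderiv ℝ φ) (A x) (b' k) (b' l)).det ≠ 0) (hJd : Jm.det ≠ 0) :
    Real.log (Matrix.of fun i j => fderiv ℝ (fderiv ℝ (φ ∘ A)) x (b i) (b j)).det - 2 * Real.log |Jm.det| =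
      Real.log (Matrix.of fun k l => fderiv ℝ (fderiv ℝ φ) (A x) (b' k) (b' l)).det := by
  rw [hessMatrix_comp_eq_of_fderiv_eq_zero hA hφ hcrit b b' Jm hJ, log_det_transpose_mul_mul _ _ hH hJd]
  ring

end Summit.QuantumFields.YangMills.Theorems.FluctuationComparisonRegPrIntLS2BetaHessianCongruence

end
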